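import Summits.QuantumAdvantage.AdviceFreeQNC0.SPSWalkPayoff
import Summits.QuantumAdvantage.AdviceFreeQNC0.TensorBlockSplit
import Summits.QuantumAdvantage.AdviceFreeQNC0.WalkTransport
import Summits.QuantumAdvantage.AdviceFreeQNC0.UnionBoundLift
import HarnessLib

/-!
# Cell qa-qnc0 (rung F-Q1, route RingFrame, crux α / density target T10): B10, ring form —
# `SPSWalkFailPoly → SPSRingFailPoly`, and the density-axis payoff chain down to MULT₁

Planner qa-qnc0-p1 gen 13, `HOME/qa-qnc0-p1/Sketch13.lean` v3 (ROUND-12 §2.9, TARGET §25.8, ask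
P17/B10).  `SPSWalkFailPoly` (ΣΠΣ_𝔽₂ hardness of the WALK game with a `1/poly` gap; the tree's
`b10W : T10W → SPSApprox → SPSWalkFailPoly`, `SPSWalkPayoff.lean`) is transported to the RING relation
`RingHLF.Rel` itself along the chart of `WalkTransport.lean`:

* `SPSRingFailPoly`, `B10R` (Sketch13 v3 VERBATIM) and **`b10R : B10R`** — PROVED.  Ring size
  `N = n+1`; the walk cuts `y_g(u) = z_g(xOfU u) ⊕ tGuess(xOfU u)_g` are again ΣΠΣ: affine forms
  pull back to affine forms along the affine chart `xOfU` (`isSPS_comp`, via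
  `HasDeg · 1 ⇔ affine form`, `exists_affEval_of_hasDeg_one`), an affine shift costs one AND gate
  (`isSPS_xor_affine`), sizes are padded (`isSPS_mono`, `(n+1)^a + 1 ≤ n^{2a+1}`); and ring failures
  dominate walk failures (`card_fail_le_card_not_rel`: the even class has `≤ 2ⁿ` patterns and the
  odd-class successes inject into walk wins by `uVec`, `rel_iff_ringWinU`).
* the composites **`spsRingFailPoly_of_t10W : T10W → SPSApprox → SPSRingFailPoly`** and
  **`spsRingFailPoly_of_tensorMultOne : TensorMultOne → SPSApprox → SPSRingFailPoly`** (block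
  splitting `blockSplit` and `tensorMultPays` are kernel): with the tree's `spsApprox`, an
  advice-free, non-interactive `QNC⁰ ⊄ ΣΠΣ_𝔽₂(poly)` separation for RingHLF with inverse-polynomial
  soundness gap now hangs on MULT₁ (`TensorMultOne`) ALONE.

The cell's theorems (not in print).  WHAT THIS IS NOT: `SPSWalkFailPoly`/`T10W`/`TensorMultOne` are
HYPOTHESES (MULT₁ open); ΣΠΣ_𝔽₂ ⊊ AC⁰[2] (AND-depth one); α untouched; no separation.
-/

noncomputable section

open scoped Classical

namespace Summit.QuantumAdvantage.AdviceFreeQNC0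

open Finset
open Literature.Computability.MetaComplexity Literature.Computability.MetaComplexity.Smolensky
open Literature.Computability.QuantumComplexity Literature.Computability.QuantumComplexity.RingHLF

/-! ### Sketch13 v3 statements (verbatim) -/

open Classical in
/-- **ΣΠΣ hardness of RingHLF itself, 1/poly gap** (the circuit-language statement): every
classical strategy for the ring relation `RingHLF.Rel` whose `n` output bits are ΣΠΣ_𝔽₂ circuits
with `≤ n^a` AND gates fails on at least `2^n / n^b` of the `2^n` inputs. Together with the
tree's quantum side of the ring game this is an advice-free, non-interactive QNC⁰ ⊄ ΣΠΣ_𝔽₂(poly)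
separation with inverse-polynomial soundness gap.  (Planner qa-qnc0-p1 Sketch13 v3, verbatim.) -/
def SPSRingFailPoly : Prop :=
  ∀ a : ℕ, ∃ b n₀ : ℕ, ∀ n ≥ n₀, ∀ z : Fin n → (Fin n → Bool) → Bool,
    (∀ i, IsSPS (n ^ a) (z i)) →
      (2 : ℝ) ^ n ≤ (n : ℝ) ^ b *
        ((univ.filter fun x : Fin n → Bool =>
            ¬ Literature.Computability.QuantumComplexity.RingHLF.Rel x (fun i => z i x)).card : ℝ)

/-- **B10 (ring form)**: `SPSWalkFailPoly → SPSRingFailPoly`.  (Sketch13 v3, verbatim; proved below.) -/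
def B10R : Prop := SPSWalkFailPoly → SPSRingFailPoly

namespace SPSRingFail

/-! ### Affine forms = degree `≤ 1` -/

/-- A Boolean function of `𝔽₂`-degree `≤ 1` is an affine form (`affEval`). -/
theorem exists_affEval_of_hasDeg_one {m : ℕ} {t : (Fin m → Bool) → Bool} (ht : HasDeg t 1) :
    ∃ ℓ : Finset (Fin m) × Bool, ∀ x, t x = affEval ℓ x := by
  set g : CubeFn (ZMod 2) m := fun x => if t x = true then 1 else 0 with hg
  have hg1 : g ∈ lowDeg (ZMod 2) m 1 := ht
  refine ⟨(univ.filter fun i : Fin m => g (basisRow i) + g (fun _ => false) = 1, t fun _ => false),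
    fun x => ?_⟩
  have key := eq_affine_of_mem_lowDeg_one hg1 x
  have z01 : ∀ a : ZMod 2, a ≠ 1 → a = 0 := by decide
  -- the coefficient sum splits over `S = {i : g eᵢ + g 0 = 1}`
  have hsum : (∑ i : Fin m, (if x i = true then (1 : ZMod 2) else 0) * (g (basisRow i) + g fun _ => false)) =
      ∑ i ∈ univ.filter (fun i : Fin m => g (basisRow i) + g (fun _ => false) = 1),
        (if x i = true then (1 : ZMod 2) else 0) := by
    rw [← sum_filter_add_sum_filter_not univ (fun i : Fin m => g (basisRow i) + g (fun _ => false) = 1)]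
    have h0 : ∑ i ∈ univ.filter (fun i : Fin m => ¬ g (basisRow i) + g (fun _ => false) = 1),
        (if x i = true then (1 : ZMod 2) else 0) * (g (basisRow i) + g fun _ => false) = 0 :=
      sum_eq_zero fun i hi => by rw [z01 _ (mem_filter.1 hi).2, mul_zero]
    rw [h0, add_zero]
    exact sum_congr rfl fun i hi => by rw [(mem_filter.1 hi).2, mul_one]
  -- compare the indicators
  have hind : (if t x = true then (1 : ZMod 2) else 0) =
      (if affEval (univ.filter (fun i : Fin m => g (basisRow i) + g (fun _ => false) = 1),
        t fun _ => false) x = true then 1 else 0) := by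
    have e := congrFun (SPSApprox.ind_affEval (univ.filter
      (fun i : Fin m => g (basisRow i) + g (fun _ => false) = 1), t fun _ => false)) x
    unfold SPSApprox.ind at e
    rw [e, Pi.add_apply, Finset.sum_apply]
    change g x = _
    rw [key, hsum]
  revert hind
  cases t x <;> cases affEval _ x <;> decide

/-! ### ΣΠΣ closure properties -/

/-- **Pullback**: composing a ΣΠΣ circuit with a map all of whose coordinates are affine keeps it
ΣΠΣ with the same number of AND gates. -/
theorem isSPS_comp {m m' s : ℕ} {f : (Fin m' → Bool) → Bool} (hf : IsSPS s f)
    (φ : (Fin m → Bool) → (Fin m' → Bool))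
    (hφ : ∀ j, (fun u => if φ u j = true then (1 : ZMod 2) else 0) ∈ lowDeg (ZMod 2) m 1) :
    IsSPS s (fun u => f (φ u)) := by
  obtain ⟨T, hT⟩ := hf
  have hpull : ∀ ℓ : Finset (Fin m') × Bool, ∃ ℓ' : Finset (Fin m) × Bool,
      ∀ u, affEval ℓ (φ u) = affEval ℓ' u := by
    intro ℓ
    have h1 : HasDeg (fun u => affEval ℓ (φ u)) 1 :=
      comp_mem_lowDeg_of_coord φ hφ (SPSApprox.ind_affEval_mem ℓ)
    exact exists_affEval_of_hasDeg_one h1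
  choose ψ hψ using hpull
  refine ⟨fun i => (T i).image ψ, fun u => ?_⟩
  beta_reduce
  rw [hT (φ u)]
  have e : (univ.filter fun i : Fin s => ∀ ℓ ∈ T i, affEval ℓ (φ u) = true) =
      univ.filter fun i : Fin s => ∀ ℓ ∈ (T i).image ψ, affEval ℓ u = true := by
    refine filter_congr fun i _ => ?_
    rw [forall_mem_image]
    exact forall₂_congr fun ℓ _ => by rw [hψ ℓ u]
  rw [e]

/-- **Affine shift**: XOR with an affine function costs one more AND gate. -/
theorem isSPS_xor_affine {m s : ℕ} {f t : (Fin m → Bool) → Bool} (hf : IsSPS s f) (ht : HasDeg t 1) :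
    IsSPS (s + 1) (fun u => xor (f u) (t u)) := by
  obtain ⟨T, hT⟩ := hf
  obtain ⟨ℓ, hℓ⟩ := exists_affEval_of_hasDeg_one ht
  refine ⟨Fin.lastCases {ℓ} T, fun x => ?_⟩
  have hB : (univ.filter fun i : Fin (s + 1) =>
      ∀ ℓ' ∈ (Fin.lastCases {ℓ} T i : Finset (Finset (Fin m) × Bool)), affEval ℓ' x = true).card =
      (univ.filter fun i : Fin s => ∀ ℓ' ∈ T i, affEval ℓ' x = true).card +
        (if affEval ℓ x = true then 1 else 0) := by
    rw [card_filter, card_filter, Fin.sum_univ_castSucc]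
    simp only [Fin.lastCases_castSucc, Fin.lastCases_last, mem_singleton, forall_eq]
  beta_reduce
  rw [hT x, hℓ x, hB]
  have e : ∀ A : ℕ, decide ((A + 1) % 2 = 1) = !decide (A % 2 = 1) := by
    intro A
    rcases Nat.mod_two_eq_zero_or_one A with h | h
    · rw [decide_eq_true (show (A + 1) % 2 = 1 by omega), decide_eq_false (show ¬ A % 2 = 1 by omega)]
      rfl
    · rw [decide_eq_false (show ¬ (A + 1) % 2 = 1 by omega), decide_eq_true h]
      rfl
  cases hb : affEval ℓ x
  · simp
  · rw [if_pos rfl, e]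
    cases decide ((univ.filter fun i : Fin s => ∀ ℓ' ∈ T i, affEval ℓ' x = true).card % 2 = 1) <;> rfl

/-- **Padding**: more AND gates can be left unused (a gate over the unsatisfiable form `(∅, false)`). -/
theorem isSPS_mono {m s s' : ℕ} {f : (Fin m → Bool) → Bool} (hf : IsSPS s f) (hs : s ≤ s') :
    IsSPS s' f := by
  obtain ⟨T, hT⟩ := hf
  refine ⟨fun i => if h : i.val < s then T ⟨i.val, h⟩ else {((∅ : Finset (Fin m)), false)},
    fun x => ?_⟩
  have hdead : affEval ((∅ : Finset (Fin m)), false) x = false := by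
    unfold affEval; simp
  have hcard : (univ.filter fun i : Fin s' =>
      ∀ ℓ ∈ (if h : i.val < s then T ⟨i.val, h⟩ else {((∅ : Finset (Fin m)), false)}),
        affEval ℓ x = true).card =
      (univ.filter fun i : Fin s => ∀ ℓ ∈ T i, affEval ℓ x = true).card := by
    symm
    refine card_bij (fun i _ => Fin.castLE hs i) ?_ ?_ ?_
    · intro i hi
      rw [mem_filter] at hi ⊢
      refine ⟨mem_univ _, ?_⟩
      have h : (Fin.castLE hs i).val < s := i.isLt
      rw [dif_pos h]
      exact hi.2
    · intro i _ j _ h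
      exact Fin.castLE_injective hs h
    · intro j hj
      rw [mem_filter] at hj
      by_cases h : j.val < s
      · refine ⟨⟨j.val, h⟩, ?_, Fin.ext rfl⟩
        rw [mem_filter]
        have h2 := hj.2
        rw [dif_pos h] at h2
        exact ⟨mem_univ _, h2⟩
      · exfalso
        have h2 := hj.2
        rw [dif_neg h] at h2
        have := h2 _ (mem_singleton_self _)
        rw [hdead] at this
        exact Bool.false_ne_true this
  beta_reduce
  rw [hT x, hcard]

/-! ### Ring failures dominate walk failures -/

/-- Along the chart of `WalkTransport.lean` (`x = xOfU u` on the odd class, `u = uVec x`), the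
number of patterns on which a ring strategy `z` violates `RingHLF.Rel` is at least the number of
walk inputs on which the transported walk strategy loses (the even class has `≤ 2ⁿ` patterns, and
odd-class successes inject into walk wins, `rel_iff_ringWinU`). -/
theorem card_fail_le_card_not_rel {n : ℕ} (hn : 2 ≤ n)
    (z : (Fin (n + 1) → Bool) → (Fin (n + 1) → Bool)) :
    (univ.filter fun u : Fin n → Bool =>
        ringWinU (n + 2) (fun g u => xor (z (xOfU u) g) (tGuess (xOfU u) g)) u = false).card ≤
      (univ.filter fun x : Fin (n + 1) → Bool => ¬ Rel x (z x)).card := by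
  set y : Fin (n + 1) → (Fin n → Bool) → Bool :=
    fun g u => xor (z (xOfU u) g) (tGuess (xOfU u) g) with hy
  set Sx := univ.filter fun x : Fin (n + 1) → Bool => Rel x (z x) with hSx
  set OddZ : (Fin (n + 1) → Bool) → Prop := fun x =>
    (univ.filter fun j : Fin (n + 1) => x j = false).card % 2 = 1 with hOddZ
  have hsplit : Sx.card = (Sx.filter OddZ).card + (Sx.filter fun x => ¬ OddZ x).card :=
    (Finset.card_filter_add_card_filter_not _).symm
  have heven : (Sx.filter fun x => ¬ OddZ x).card ≤ 2 ^ n := by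
    refine le_trans (Finset.card_le_card ?_) card_even_class_le
    intro x hx
    rw [mem_filter] at hx ⊢
    exact ⟨mem_univ _, hx.2⟩
  have hodd : (Sx.filter OddZ).card ≤
      (univ.filter fun u : Fin n → Bool => ringWinU (n + 2) y u = true).card := by
    refine Finset.card_le_card_of_injOn uVec ?_ ?_
    · intro x hx
      rw [Finset.mem_coe, mem_filter, hSx, mem_filter] at hx
      rw [Finset.mem_coe, mem_filter]
      exact ⟨mem_univ _, (rel_iff_ringWinU hn x hx.2 z).1 hx.1.2⟩
    · intro x₁ hx₁ x₂ hx₂ h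
      rw [Finset.mem_coe, mem_filter] at hx₁ hx₂
      rw [← xOfU_uVec hn x₁ hx₁.2, ← xOfU_uVec hn x₂ hx₂.2, h]
  have htotal := Finset.card_filter_add_card_filter_not (s := (univ : Finset (Fin (n + 1) → Bool)))
    (fun x => Rel x (z x))
  rw [card_univ, Fintype.card_fun, Fintype.card_bool, Fintype.card_fin] at htotal
  have hwalk := TensorBlocks.failCount_add_card_win (ringWinU (n + 2) y)
  unfold failCount at hwalk
  have h2 : 2 ^ (n + 1) = 2 * 2 ^ n := by rw [pow_succ, mul_comm]
  have hSle : Sx.card ≤ 2 ^ n + (univ.filter fun u : Fin n → Bool => ringWinU (n + 2) y u = true).card := by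
    omega
  have : Sx.card = (univ.filter fun x : Fin (n + 1) → Bool => Rel x (z x)).card := rfl
  omega

/-- Size padding: `(n+1)^a + 1 ≤ n^{2a+1}` for `n ≥ 2`. -/
theorem succ_pow_add_one_le {n : ℕ} (hn : 2 ≤ n) (a : ℕ) : (n + 1) ^ a + 1 ≤ n ^ (2 * a + 1) := by
  have h1 : n + 1 ≤ n ^ 2 := by nlinarith
  have h2 : (n + 1) ^ a ≤ n ^ (2 * a) := by
    rw [pow_mul]; exact Nat.pow_le_pow_left h1 a
  have h3 : 1 ≤ n ^ (2 * a) := Nat.one_le_pow _ _ (by omega)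
  calc (n + 1) ^ a + 1 ≤ n ^ (2 * a) + n ^ (2 * a) := by omega
    _ = 2 * n ^ (2 * a) := by ring
    _ ≤ n * n ^ (2 * a) := Nat.mul_le_mul_right _ hn
    _ = n ^ (2 * a + 1) := by ring

end SPSRingFail

open SPSRingFail

/-! ### The theorems -/

/-- **B10 (ring form) — PROVED**: `SPSWalkFailPoly → SPSRingFailPoly` (exponents `a ↦ 2a+1` on the
walk side, `b ↦ b+1`, `n₀ ↦ max(n₀+1, 3)`).  The cell's theorem (qa-qnc0-p1 Sketch13 v3). -/
theorem b10R : B10R := by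
  intro hW a
  obtain ⟨b, n₀, hWn⟩ := hW (2 * a + 1)
  refine ⟨b + 1, max (n₀ + 1) 3, ?_⟩
  intro N hN z hz
  obtain ⟨n, rfl⟩ : ∃ n, N = n + 1 := ⟨N - 1, by have := le_max_right (n₀ + 1) 3; omega⟩
  have hn₀ : n₀ ≤ n := by have := le_max_left (n₀ + 1) 3; omega
  have hn2 : 2 ≤ n := by have := le_max_right (n₀ + 1) 3; omega
  -- the transported walk strategy is ΣΠΣ
  set zm : (Fin (n + 1) → Bool) → (Fin (n + 1) → Bool) := fun x i => z i x with hzm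
  set y : Fin (n + 1) → (Fin n → Bool) → Bool :=
    fun g u => xor (zm (xOfU u) g) (tGuess (xOfU u) g) with hy
  have hy : ∀ g, IsSPS (n ^ (2 * a + 1)) (y g) := by
    intro g
    have h1 : IsSPS ((n + 1) ^ a) (fun u : Fin n → Bool => z g (xOfU u)) :=
      isSPS_comp (hz g) xOfU ind_xOfU_mem
    have h2 : HasDeg (fun u : Fin n → Bool => tGuess (xOfU u) g) 1 :=
      comp_mem_lowDeg_of_coord xOfU ind_xOfU_mem (tGuess_mem_lowDeg_one g)
    exact isSPS_mono (isSPS_xor_affine h1 h2) (succ_pow_add_one_le hn2 a)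
  have hwalk := hWn n hn₀ (n + 2) y hy
  have htr := card_fail_le_card_not_rel hn2 zm
  -- arithmetic: `2^{n+1} = 2·2^n ≤ 2·n^b·F_u ≤ 2·n^b·F_x ≤ (n+1)^{b+1}·F_x`
  have htrR : ((univ.filter fun u : Fin n → Bool => ringWinU (n + 2) y u = false).card : ℝ) ≤
      ((univ.filter fun x : Fin (n + 1) → Bool => ¬ Rel x (zm x)).card : ℝ) := by
    exact_mod_cast htr
  have hnb : 2 * (n : ℝ) ^ b ≤ ((n + 1 : ℕ) : ℝ) ^ (b + 1) := by
    have h1 : 2 * n ^ b ≤ (n + 1) ^ (b + 1) := by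
      rw [pow_succ, mul_comm]
      exact Nat.mul_le_mul (Nat.pow_le_pow_left (by omega) b) (by omega)
    exact_mod_cast h1
  have hF0 : (0 : ℝ) ≤ ((univ.filter fun x : Fin (n + 1) → Bool => ¬ Rel x (zm x)).card : ℝ) :=
    Nat.cast_nonneg _
  have hnb0 : (0 : ℝ) ≤ (n : ℝ) ^ b := by positivity
  calc (2 : ℝ) ^ (n + 1) = 2 * (2 : ℝ) ^ n := by ring
    _ ≤ 2 * ((n : ℝ) ^ b *
        ((univ.filter fun u : Fin n → Bool => ringWinU (n + 2) y u = false).card : ℝ)) := by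
        linarith
    _ ≤ 2 * ((n : ℝ) ^ b *
        ((univ.filter fun x : Fin (n + 1) → Bool => ¬ Rel x (zm x)).card : ℝ)) := by
        nlinarith [mul_le_mul_of_nonneg_left htrR hnb0]
    _ = (2 * (n : ℝ) ^ b) *
        ((univ.filter fun x : Fin (n + 1) → Bool => ¬ Rel x (zm x)).card : ℝ) := by ring
    _ ≤ ((n + 1 : ℕ) : ℝ) ^ (b + 1) *
        ((univ.filter fun x : Fin (n + 1) → Bool => ¬ Rel x (zm x)).card : ℝ) :=
        mul_le_mul_of_nonneg_right hnb hF0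

/-- **The density-axis payoff, conditional on T10W**: `T10W → SPSApprox → SPSRingFailPoly`. -/
theorem spsRingFailPoly_of_t10W (hT : T10W) (hA : SPSApprox) : SPSRingFailPoly :=
  b10R (b10W hT hA)

/-- **The density-axis payoff, conditional on MULT₁ alone**: `TensorMultOne → SPSApprox →
SPSRingFailPoly` (block splitting and `TensorMultPays` are theorems).  With the tree's `spsApprox` the
only hypothesis left is `TensorMultOne`. -/
theorem spsRingFailPoly_of_tensorMultOne (hM : TensorMultOne) (hA : SPSApprox) : SPSRingFailPoly :=
  spsRingFailPoly_of_t10W (t10W_of_tensorMultOne hM) hA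

/-- **Unconditional in everything but MULT₁**: `TensorMultOne → SPSRingFailPoly`. -/
theorem spsRingFailPoly_of_tensorMultOne' (hM : TensorMultOne) : SPSRingFailPoly :=
  spsRingFailPoly_of_tensorMultOne hM spsApprox

end Summit.QuantumAdvantage.AdviceFreeQNC0
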